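import Literature.Algebra.Polynomial.CasasAlvero.Degree4
import HarnessLib

/-!
# Reduction of `CA_d(K)` to depressed polynomials

When `d ≠ 0` in the field `K`, the Taylor shift by `-a_{d-1}/d` kills the coefficient of `X^{d-1}`, and a depressed pure power
`(X - a)^d` has `a = 0`.  Hence `CA_d(K)` is equivalent to its restriction to DEPRESSED monic polynomials (`coeff (d-1) = 0`) with
conclusion `f = X^d` — the normal form in which every computation of this directory (and of the literature) is carried out.
[cite: GrafVonBothmerEtAl2007, Sec. 2]
-/

noncomputable section

open Polynomial

namespace Literature.Algebra.Polynomial.CasasAlvero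

variable {K : Type*} [Field K]

/-- the top Hasse derivative `H_{d-1} f` of a monic polynomial of degree `d ≥ 1` is `d·X + a_{d-1}`. [folklore] -/
theorem hasseDeriv_natDegree_sub_one {f : K[X]} {d : ℕ} (hf : f.Monic) (hd : f.natDegree = d) (hd1 : 1 ≤ d) :
    hasseDeriv (d - 1) f = C (d : K) * X + C (f.coeff (d - 1)) := by
  ext n
  rw [hasseDeriv_coeff, coeff_add, coeff_C_mul, coeff_X, coeff_C]
  rcases n with _ | _ | n
  · simp
  · have h1 : 0 + 1 + (d - 1) = d := by omega
    have hlc : f.coeff d = 1 := by rw [← hd]; exact hf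
    rw [h1, hlc, show (1 : ℕ) = 0 + 1 from rfl]
    simp only [zero_add, ↓reduceIte, mul_one, one_ne_zero, add_zero]
    rw [show d.choose (d - 1) = d by rw [Nat.choose_symm hd1, Nat.choose_one_right]]
  · have hgt : f.natDegree < n + 1 + 1 + (d - 1) := by omega
    rw [coeff_eq_zero_of_natDegree_lt hgt]
    simp

/-- the Taylor shift of a monic polynomial of degree `d` is monic of degree `d`. [folklore] -/
theorem monic_taylor {f : K[X]} (hf : f.Monic) (r : K) : (taylor r f).Monic := by
  rw [Monic, leadingCoeff, natDegree_taylor, taylor_coeff]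
  have hC : hasseDeriv f.natDegree f = C (1 : K) := by
    ext n
    rw [hasseDeriv_coeff, coeff_C]
    rcases n with _ | n
    · simp only [zero_add, Nat.choose_self, Nat.cast_one, one_mul, ↓reduceIte]; exact hf
    · rw [coeff_eq_zero_of_natDegree_lt (by omega)]; simp
  rw [hC, eval_C]

/-- after the shift by `r = -a_{d-1}/d` the coefficient of `X^{d-1}` vanishes (`d ≠ 0` in `K`). [folklore] -/
theorem coeff_taylor_natDegree_sub_one_eq_zero {f : K[X]} {d : ℕ} (hf : f.Monic) (hd : f.natDegree = d) (hd1 : 1 ≤ d)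
    (hK : (d : K) ≠ 0) : (taylor (-(f.coeff (d - 1)) / (d : K)) f).coeff (d - 1) = 0 := by
  rw [taylor_coeff, hasseDeriv_natDegree_sub_one hf hd hd1]
  simp only [eval_add, eval_mul, eval_C, eval_X]
  field_simp
  ring

/-- a depressed pure `d`-th power is `X^d`: if `(X - a)^d` has vanishing `X^{d-1}`-coefficient and `d ≠ 0` in `K` then `a = 0`. [folklore] -/
theorem eq_zero_of_depressed_pow {a : K} {d : ℕ} (hd1 : 1 ≤ d) (hK : (d : K) ≠ 0)
    (h : (((X : K[X]) - C a) ^ d).coeff (d - 1) = 0) : a = 0 := by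
  rw [sub_eq_add_neg, ← map_neg C a, coeff_X_add_C_pow] at h
  rw [show d - (d - 1) = 1 by omega, pow_one, show d.choose (d - 1) = d by
    rw [Nat.choose_symm hd1, Nat.choose_one_right]] at h
  rcases mul_eq_zero.mp h with h | h
  · exact neg_eq_zero.mp h
  · exact absurd h hK

/-- **Reduction to depressed polynomials.**  If `d ≠ 0` in `K`, then `CA_d(K)` holds iff every DEPRESSED monic Casas-Alvero polynomial
of degree `d` over `K` equals `X^d`. [cite: GrafVonBothmerEtAl2007, Sec. 2] -/
theorem holdsInDegree_iff_depressed {d : ℕ} (hd1 : 1 ≤ d) (hK : (d : K) ≠ 0) :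
    HoldsInDegree K d ↔
      ∀ g : K[X], g.Monic → g.natDegree = d → g.coeff (d - 1) = 0 → IsCasasAlvero g → g = X ^ d := by
  constructor
  · intro h g hg hgd hdep hca
    obtain ⟨a, ha⟩ := h g hg hgd hca
    have ha0 : a = 0 := eq_zero_of_depressed_pow hd1 hK (by rw [← ha]; exact hdep)
    rw [ha, ha0, map_zero, sub_zero]
  · intro h f hf hfd hca
    set r : K := -(f.coeff (d - 1)) / (d : K) with hr
    have hg := h (taylor r f) (monic_taylor hf r) (by rw [natDegree_taylor, hfd])
      (coeff_taylor_natDegree_sub_one_eq_zero hf hfd hd1 hK) (hca.taylor r)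
    refine ⟨r, ?_⟩
    have hback : f = taylor (-r) (taylor r f) := by rw [taylor_taylor, neg_add_cancel, taylor_zero]
    rw [hback, hg, taylor_apply, X_pow_comp, map_neg, ← sub_eq_add_neg]

end Literature.Algebra.Polynomial.CasasAlvero
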